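import Summits.AtomisticToContinuum.HydrodynamicLimit.Theses.RelayRaceLocality
import Summits.AtomisticToContinuum.HydrodynamicLimit.Theorems.ImplosionDichotomyHydroLimitInBandEquilibrium
import Summits.AtomisticToContinuum.HydrodynamicLimit.Theorems.RelayRaceLocalityConeLocalisationConeTransfer
import Literature.Analysis.FluidPDE.HardSpherePhaseSpaceProofs
import Summits.AtomisticToContinuum.HydrodynamicLimit.Theorems.DensityCap.Negative.EosIdeal

/-!
# `LightConeInLaw` (stmt-AtomisticToContinuum-12500): load-bearing clauses — the homogeneous two-state witness

Negative-side lemmas for the crux `RelayRaceLocality.LightConeInLaw` (two-copy light cone in law), from the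
standing disprover's `Cruxes/LightConeInLaw/Disproof.lean` §2 (cycle 1). WITNESS (no non-equilibrium dynamics,
only theorems of the tree): gas 1 and gas 2 are the SAME hard-sphere gas (`N + 1` spheres of diameter
`hsDiameter σ N`, Alexander's flows) in two HOMOGENEOUS local Gibbs states `(1, 0, 1)` and `(1, u_c, θ₂)` with
`|u_c|²/2 + 3θ₂/2 ≠ 3/2`; their Euler data are constant classical solutions (`IsHardSphereEulerSolutionDim.const`),
tied at `t = 0` by the tree's cluster-expansion LLN (`PolynomialCompressionPDE.admissible_iff_data`,
`rhoLim_constActivity_eq_one`); homogeneous Gibbs laws are flow-invariant, so the LLN holds at every time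
(`tendstoHydroFieldsAt_of_zero_of_const_profiles`). Tested against `χ ≡ 1` the reduced energies concentrate at
`(3/2)σ³` and `σ³(|u_c|²/2 + 3θ₂/2)`; two laws concentrating at different points do not merge in the
bounded-Lipschitz sense (`relayRaceLocality_coneTransfer` + uniqueness of limits in probability):
`not_merging_of_energy_ne`.

CONSEQUENCES. Each theorem below negates the crux VERBATIM with ONE clause weakened or deleted (statements inlined;
they carry the names `LightConeInLawWithout{ThermalAgreement,VelocityAgreement,Support,TieOne,TieTwo}` in
`Cruxes/LightConeInLaw/Disproof.lean`): the crux is FALSE without the TEMPERATURE part of the agreement clause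
(`θ = 1` vs `2`, `t = 1`, `R = c + 1` so that `χ ≡ 1` is admissible: `R - c t = 1 > √3/2 ≥ dist`), without its
VELOCITY part (drifting gas `(1, e₀, 1)`, `‖e₀‖ = 1`), without the SUPPORT clause of `χ` (at `R = 0` the agreement
clause is vacuous), and without either `t = 0` TIE (that gas is then an untied homogeneous state with fictitious
Euler data equal to the other gas's). So a proof must use all of these; the degenerate radius `R ≤ 0` is harmless
ONLY through the support clause; restricting to `0 < t` rescues nothing (the witness is stationary in law). The
reduced-density part of the agreement clause is not reached by homogeneous witnesses with `n₂ N = N + 1`.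
refuter-cdisprove-stmt-AtomisticToContinuum-12500-0.
-/

noncomputable section

open MeasureTheory Filter Set Topology
open scoped ENNReal
open Literature.MathematicalPhysics.KineticTheory Literature.Analysis.FluidPDE

namespace Summit.AtomisticToContinuum.HydrodynamicLimit.Theorems

namespace LightConeInLawNegative

/-! ### Small tools -/

/-- A sequence of random variables cannot concentrate at two different points (laws of total mass `1`).
[folklore] -/
theorem false_of_two_limits {Ω : ℕ → Type*} [∀ N, MeasurableSpace (Ω N)]
    {P : (N : ℕ) → Measure (Ω N)} (hP : ∀ N, P N Set.univ = 1) {F : (N : ℕ) → Ω N → ℝ} {a b : ℝ}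
    (hne : a ≠ b) (ha : ∀ δ > (0 : ℝ), Tendsto (fun N => P N {z | δ < |F N z - a|}) atTop (𝓝 0))
    (hb : ∀ δ > (0 : ℝ), Tendsto (fun N => P N {z | δ < |F N z - b|}) atTop (𝓝 0)) : False := by
  have hab : 0 < |a - b| := abs_pos.2 (sub_ne_zero.2 hne)
  have hle : ∀ N, (1 : ℝ≥0∞) ≤
      P N {z | |a - b| / 3 < |F N z - a|} + P N {z | |a - b| / 3 < |F N z - b|} := by
    intro N
    rw [← hP N]
    refine (measure_mono fun z _ => ?_).trans (measure_union_le _ _)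
    by_contra hz
    simp only [Set.mem_union, Set.mem_setOf_eq, not_or, not_lt] at hz
    have h1 : |a - b| ≤ |F N z - a| + |F N z - b| := by
      calc |a - b| = |(F N z - b) - (F N z - a)| := by ring_nf
        _ ≤ |F N z - b| + |F N z - a| := abs_sub _ _
        _ = |F N z - a| + |F N z - b| := add_comm _ _
    linarith [hz.1, hz.2]
  have h0 : Tendsto (fun N => P N {z | |a - b| / 3 < |F N z - a|} +
      P N {z | |a - b| / 3 < |F N z - b|}) atTop (𝓝 0) := by
    simpa using (ha _ (by positivity)).add (hb _ (by positivity))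
  exact absurd (ge_of_tendsto' h0 hle) (by simp)

/-- The energy limit of the homogeneous state `(1, u_c, θ)` tested against `χ ≡ 1` is `|u_c|²/2 + 3θ/2`.
[folklore] -/
theorem integral_one_mul_totalEnergyDensity (uc : V3) (θ : ℝ) :
    ∫ x : T3, (fun _ : T3 => (1 : ℝ)) x * totalEnergyDensity 1 uc θ = ‖uc‖ ^ 2 / 2 + 3 / 2 * θ := by
  simp [totalEnergyDensity]

/-! ### Statics and stationarity of the homogeneous gas (from the tree) -/

/-- **Law of large numbers at every time for the homogeneous gas `(1, u_c, θ)`.** There is `σ₁ > 0` such that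
for `0 < σ < σ₁` and every flow family, under the homogeneous local Gibbs laws the three empirical fields at every
time `t` converge in probability to those of the constant state `(1, u_c, θ)`: the `t = 0` tie is the tree's
cluster-expansion LLN with pinned density `rhoLim ≡ 1` (`admissible_iff_data`, `rhoLim_constActivity_eq_one`),
and the homogeneous Gibbs law is invariant under every hard-sphere flow
(`tendstoHydroFieldsAt_of_zero_of_const_profiles`). [folklore] -/
theorem homogeneous_lln_all_times {θ : ℝ} (hθ : 0 < θ) (uc : V3) :
    ∃ σ₁ : ℝ, 0 < σ₁ ∧ ∀ σ : ℝ, 0 < σ → σ < σ₁ →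
      ∀ (Φ : (N : ℕ) → HardSphereFlow (Torus.geometry (Fin 3)) (hsDiameter σ N) (N + 1)) (t : ℝ),
        TendstoHydroFieldsAt (fun N => localGibbsLaw σ (fun _ => 1) (fun _ => uc) (fun _ => θ) N (Φ N)) Φ
          (fun _ _ => 1) (fun _ _ => uc) (fun _ _ => θ) t := by
  obtain ⟨σ₁, hσ₁, -, A⟩ := PolynomialCompressionPDE.admissible_iff_data (a₀ := fun _ : T3 => (1 : ℝ))
    (θ₀ := fun _ : T3 => θ) (u₀ := fun _ : T3 => uc) continuous_const continuous_const
    continuous_const (fun _ => one_pos) (fun _ => hθ)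
  refine ⟨σ₁, hσ₁, fun σ hσ hσlt Φ t => ?_⟩
  obtain ⟨hsd, A'⟩ := A σ hσ hσlt
  have h0 : ∀ Ψ : PolynomialCompressionPDE.Flows σ, TendstoHydroFieldsAt
      (fun N => localGibbsLaw σ (fun _ => 1) (fun _ => uc) (fun _ => θ) N (Ψ N)) Ψ
        (fun _ _ => (1 : ℝ)) (fun _ _ => uc) (fun _ _ => θ) 0 := by
    refine (A' (fun _ _ => (1 : ℝ)) (fun _ _ => θ) (fun _ _ => uc) continuous_const
      continuous_const continuous_const).2 ⟨?_, rfl, rfl⟩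
    exact (HydroLimitInBandEquilibrium.rhoLim_constActivity_eq_one one_pos hsd).symm
  exact tendstoHydroFieldsAt_of_zero_of_const_profiles σ 1 θ uc Φ rfl rfl rfl (h0 Φ)

/-- Concentration of the reduced energy `σ³ e_N(1)` (test function `χ ≡ 1`) of the homogeneous gas `(1, u_c, θ)` at
`σ³ (|u_c|²/2 + 3θ/2)`, at every time. [folklore] -/
theorem energy_concentrates {θ : ℝ} (hθ : 0 < θ) (uc : V3) :
    ∃ σ₁ : ℝ, 0 < σ₁ ∧ ∀ σ : ℝ, 0 < σ → σ < σ₁ →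
      ∀ (Φ : (N : ℕ) → HardSphereFlow (Torus.geometry (Fin 3)) (hsDiameter σ N) (N + 1)) (t : ℝ),
        ∀ δ > (0 : ℝ), Tendsto (fun N => localGibbsLaw σ (fun _ => 1) (fun _ => uc) (fun _ => θ) N (Φ N)
          {z | δ < |σ ^ 3 * empiricalEnergyField ((Φ N).flow t z) (fun _ => 1) -
            σ ^ 3 * (‖uc‖ ^ 2 / 2 + 3 / 2 * θ)|}) atTop (𝓝 0) := by
  obtain ⟨σ₁, hσ₁, H⟩ := homogeneous_lln_all_times hθ uc
  refine ⟨σ₁, hσ₁, fun σ hσ hσlt Φ t δ hδ => ?_⟩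
  have hσ3 : 0 < σ ^ 3 := pow_pos hσ 3
  have h := ((H σ hσ hσlt Φ t) (fun _ => 1) continuous_const (δ / σ ^ 3) (by positivity)).2.2
  rw [integral_one_mul_totalEnergyDensity] at h
  refine h.congr fun N => ?_
  congr 1
  ext z
  simp only [Set.mem_setOf_eq]
  rw [← mul_sub, abs_mul, abs_of_pos hσ3, div_lt_iff₀ hσ3, mul_comm]

/-! ### The core: two homogeneous states with different energy densities do not merge -/

/-- **Two homogeneous gases with different energy densities do not merge in the bounded-Lipschitz sense.** For
`0 < σ` small, every flow family and every time `t`, it is FALSE that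
`E₁ F(σ³ρ_N(1), σ³m_N(1), σ³e_N(1)) - E₂ F(…) → 0` for all `1`-Lipschitz `F` bounded by `1`, when `E₁` is the
homogeneous local Gibbs law `(1, 0, 1)` and `E₂` the homogeneous local Gibbs law `(1, u_c, θ₂)` with
`|u_c|²/2 + 3θ₂/2 ≠ 3/2`: by `relayRaceLocality_coneTransfer` the merging would transport the concentration of gas
2's reduced energy at `σ³(|u_c|²/2 + 3θ₂/2)` to gas 1, whose reduced energy concentrates at `(3/2)σ³` — two
distinct limits in probability. [folklore] -/
theorem not_merging_of_energy_ne (uc : V3) {θ₂ : ℝ} (hθ₂ : 0 < θ₂)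
    (hne : (3 / 2 : ℝ) ≠ ‖uc‖ ^ 2 / 2 + 3 / 2 * θ₂) :
    ∃ σ₁ : ℝ, 0 < σ₁ ∧ ∀ σ : ℝ, 0 < σ → σ < σ₁ →
      ∀ (Φ : (N : ℕ) → HardSphereFlow (Torus.geometry (Fin 3)) (hsDiameter σ N) (N + 1)) (t : ℝ),
      ¬ (∀ F : ℝ × V3 × ℝ → ℝ, LipschitzWith 1 F → (∀ p, |F p| ≤ 1) →
        Tendsto (fun N =>
          (∫ z, F (σ ^ 3 * empiricalDensityField ((Φ N).flow t z) (fun _ => 1),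
              (σ ^ 3) • empiricalMomentumField ((Φ N).flow t z) (fun _ => 1),
              σ ^ 3 * empiricalEnergyField ((Φ N).flow t z) (fun _ => 1))
            ∂(localGibbsLaw σ (fun _ => 1) (fun _ => 0) (fun _ => 1) N (Φ N))) -
          ∫ z, F (σ ^ 3 * empiricalDensityField ((Φ N).flow t z) (fun _ => 1),
              (σ ^ 3) • empiricalMomentumField ((Φ N).flow t z) (fun _ => 1),
              σ ^ 3 * empiricalEnergyField ((Φ N).flow t z) (fun _ => 1))
            ∂(localGibbsLaw σ (fun _ => 1) (fun _ => uc) (fun _ => θ₂) N (Φ N))) atTop (𝓝 0)) := by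
  obtain ⟨σA, hσA, HA⟩ := energy_concentrates one_pos (0 : V3)
  obtain ⟨σB, hσB, HB⟩ := energy_concentrates hθ₂ uc
  refine ⟨min (min σA σB) (1 / 2), by positivity, fun σ hσ hσlt Φ t hM => ?_⟩
  have hσA' : σ < σA := lt_of_lt_of_le hσlt ((min_le_left _ _).trans (min_le_left _ _))
  have hσB' : σ < σB := lt_of_lt_of_le hσlt ((min_le_left _ _).trans (min_le_right _ _))
  have hσ2 : σ ≤ 1 / 2 := (lt_of_lt_of_le hσlt (min_le_right _ _)).le
  set P₁ : (N : ℕ) → Measure (Config (N + 1) (Fin 3) T3) :=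
    fun N => localGibbsLaw σ (fun _ => 1) (fun _ => 0) (fun _ => 1) N (Φ N) with hP₁
  set P₂ : (N : ℕ) → Measure (Config (N + 1) (Fin 3) T3) :=
    fun N => localGibbsLaw σ (fun _ => 1) (fun _ => uc) (fun _ => θ₂) N (Φ N) with hP₂
  haveI hI₁ : ∀ N, IsProbabilityMeasure (P₁ N) := fun N =>
    isProbabilityMeasure_localGibbsLaw continuous_const continuous_const continuous_const
      (fun _ => one_pos) (fun _ => one_pos) hσ2 N (Φ N)
  haveI hI₂ : ∀ N, IsProbabilityMeasure (P₂ N) := fun N =>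
    isProbabilityMeasure_localGibbsLaw continuous_const continuous_const continuous_const
      (fun _ => one_pos) (fun _ => hθ₂) hσ2 N (Φ N)
  -- the reduced energy of the whole gas at time `t`, as a random variable on the initial phase space
  set X : (N : ℕ) → Config (N + 1) (Fin 3) T3 → ℝ :=
    fun N z => σ ^ 3 * empiricalEnergyField ((Φ N).flow t z) (fun _ => 1) with hX
  have hXm : ∀ N, Measurable (X N) := fun N =>
    ((measurable_empiricalEnergyField (N := N + 1) continuous_const).comp ((Φ N).measurable_flow t)).const_mul _
  have hF : ∀ F : ℝ → ℝ, LipschitzWith 1 F → (∀ p, |F p| ≤ 1) →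
      Tendsto (fun N => (∫ z, F (X N z) ∂P₁ N) - ∫ z, F (X N z) ∂P₂ N)
        atTop (𝓝 0) := by
    intro F hFl hFb
    have hlip : LipschitzWith 1 (fun p : ℝ × V3 × ℝ => F p.2.2) := by
      have h1 : LipschitzWith (1 * (1 * 1)) (F ∘ (Prod.snd ∘ Prod.snd) : ℝ × V3 × ℝ → ℝ) :=
        hFl.comp ((LipschitzWith.prod_snd (α := V3) (β := ℝ)).comp
          (LipschitzWith.prod_snd (α := ℝ) (β := V3 × ℝ)))
      rw [mul_one, mul_one] at h1
      exact h1
    have h := hM (fun p => F p.2.2) hlip (fun p => hFb p.2.2)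
    exact h
  have h₂ : ∀ δ : ℝ, 0 < δ → Tendsto (fun N => P₂ N
      {z | δ < dist (X N z) (σ ^ 3 * (‖uc‖ ^ 2 / 2 + 3 / 2 * θ₂))}) atTop (𝓝 0) := by
    intro δ hδ
    simpa [Real.dist_eq] using HB σ hσ hσB' Φ t δ hδ
  have h₁ := relayRaceLocality_coneTransfer P₁ P₂ hXm hXm (σ ^ 3 * (‖uc‖ ^ 2 / 2 + 3 / 2 * θ₂)) hF h₂
  have h₁' := HA σ hσ hσA' Φ t
  have hσ3 : 0 < σ ^ 3 := pow_pos hσ 3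
  have hne' : σ ^ 3 * (‖uc‖ ^ 2 / 2 + 3 / 2 * θ₂) ≠ σ ^ 3 * (‖(0 : V3)‖ ^ 2 / 2 + 3 / 2 * 1) := by
    intro heq
    have h3 := mul_left_cancel₀ hσ3.ne' heq
    rw [norm_zero] at h3
    exact hne (by rw [h3]; ring)
  exact false_of_two_limits (P := P₁) (fun N => measure_univ) (F := X) hne'
    (fun δ hδ => by simpa [Real.dist_eq] using h₁ δ hδ) (fun δ hδ => h₁' δ hδ)

/-! ### Refutations of the clause-weakened variants (statements inlined: the crux verbatim with ONE clause changed) -/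

/-- A reduced density below six positive thresholds. [folklore] -/
theorem exists_small (a b c d e f : ℝ) (ha : 0 < a) (hb : 0 < b) (hc : 0 < c) (hd : 0 < d) (he : 0 < e)
    (hf : 0 < f) : ∃ σ : ℝ, 0 < σ ∧ σ < a ∧ σ < b ∧ σ < c ∧ σ < d ∧ σ < e ∧ σ < f := by
  set m : ℝ := min (min (min a b) (min c d)) (min e f) with hm
  have hm0 : 0 < m := by positivity
  have f1 : m ≤ min (min a b) (min c d) := min_le_left _ _
  have f2 : m ≤ min e f := min_le_right _ _
  have f3 : min (min a b) (min c d) ≤ min a b := min_le_left _ _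
  have f4 : min (min a b) (min c d) ≤ min c d := min_le_right _ _
  have f5 : min a b ≤ a := min_le_left _ _
  have f6 : min a b ≤ b := min_le_right _ _
  have f7 : min c d ≤ c := min_le_left _ _
  have f8 : min c d ≤ d := min_le_right _ _
  have f9 : min e f ≤ e := min_le_left _ _
  have f10 : min e f ≤ f := min_le_right _ _
  exact ⟨m / 2, by positivity, by linarith, by linarith, by linarith, by linarith, by linarith, by linarith⟩

/-- Common set-up of the witnesses: a reduced density below the four thresholds, `< 1/2`, with `σ³ < η₀`, and a
flow family at that density (Alexander). [folklore] -/
theorem exists_small_flows (σ₀ σW σA σB η₀ : ℝ) (h₀ : 0 < σ₀) (hW : 0 < σW) (hA : 0 < σA) (hB : 0 < σB)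
    (hη : 0 < η₀) : ∃ σ : ℝ, 0 < σ ∧ σ < σ₀ ∧ σ < σW ∧ σ < σA ∧ σ < σB ∧ σ < 1 / 2 ∧ σ ^ 3 < η₀ ∧
      Nonempty ((N : ℕ) → HardSphereFlow (Torus.geometry (Fin 3)) (hsDiameter σ N) (N + 1)) := by
  obtain ⟨σ, hσ, h1, h2, h3, h4, h5, h6⟩ := exists_small σ₀ σW σA σB (1 / 2) η₀ h₀ hW hA hB one_half_pos hη
  exact ⟨σ, hσ, h1, h2, h3, h4, h5, lt_of_le_of_lt (pow_le_of_le_one hσ.le (by linarith) three_ne_zero) h6,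
    PolynomialCompressionPDE.flows_nonempty hσ h5⟩

/-- The homogeneous local Gibbs laws `(1, u_c, θ)` are probability measures (`σ ≤ 1/2`). [folklore] -/
theorem isProb_homogeneous {σ : ℝ} (hσ2 : σ < 1 / 2) (uc : V3) {θ : ℝ} (hθ : 0 < θ)
    (Φ : (N : ℕ) → HardSphereFlow (Torus.geometry (Fin 3)) (hsDiameter σ N) (N + 1)) (N : ℕ) :
    IsProbabilityMeasure (localGibbsLaw σ (fun _ => 1) (fun _ => uc) (fun _ => θ) N (Φ N)) :=
  isProbabilityMeasure_localGibbsLaw continuous_const continuous_const continuous_const (fun _ => one_pos)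
    (fun _ => hθ) hσ2.le N (Φ N)

/-- The constant states `(1, u_c, θ)` are classical hard-sphere Euler solutions on `[0, 2)`. [folklore] -/
theorem constSol (σ : ℝ) (uc : V3) {θ : ℝ} (hθ : 0 < θ) :
    IsHardSphereEulerSolution σ 2 (fun _ _ => 1) (fun _ _ => uc) (fun _ _ => θ) :=
  isHardSphereEulerSolutionDim_three_iff.1 (IsHardSphereEulerSolutionDim.const σ 2 uc one_pos hθ)

/-- **The crux without thermal agreement is false** (`[load-bearing: Θ-agreement]`). Witness: `M = 2`, the two
homogeneous gases `(1, 0, 1)` / `(1, 0, 2)` at a common small reduced density `σ₁ = σ₂ = σ` (`n₂ N = N + 1`,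
Alexander's flows, constant Euler states, `T₁ = T₂ = 2`), `t = 1`, `x₀ = 0`, `R = c + 1`, `χ ≡ 1`; reduced density
and velocity agree everywhere, the guards hold (`σ³ < η₀`, `θ ≤ 2`, `u = 0`), `χ ≡ 1` vanishes where
`1 ≤ dist` (nowhere), and the conclusion contradicts `not_merging_two_temperatures`. [folklore] -/
theorem lightConeInLaw_false_without_thermalAgreement :
    ¬ (open Literature.MathematicalPhysics.KineticTheory Literature.Analysis.FluidPDE MeasureTheory Filter in ∃ η₀ : ℝ, 0 < η₀ ∧ ∀ M : ℝ, 0 < M → ∃ c : ℝ, 0 < c ∧ ∀ (a₁ θ₁ a₂ θ₂ : T3 → ℝ) (u₁ u₂ : T3 → V3), Continuous a₁ → Continuous θ₁ → Continuous u₁ → Continuous a₂ → Continuous θ₂ → Continuous u₂ → (∀ x, 0 < a₁ x) → (∀ x, 0 < θ₁ x) → (∀ x, 0 < a₂ x) → (∀ x, 0 < θ₂ x) → ∃ σ₀ : ℝ, 0 < σ₀ ∧ ∀ (σ₁ σ₂ : ℝ), 0 < σ₁ → σ₁ < σ₀ → 0 < σ₂ → σ₂ < σ₀ → ∀ n₂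 : ℕ → ℕ, Tendsto (fun N => (n₂ N : ℝ) * hsDiameter σ₁ N ^ 3) atTop (nhds (σ₂ ^ 3)) → ∀ (T₁ T₂ : ℝ) (ρ₁ Θ₁ ρ₂ Θ₂ : ℝ → T3 → ℝ) (U₁ U₂ : ℝ → T3 → V3), IsHardSphereEulerSolution σ₁ T₁ ρ₁ U₁ Θ₁ → IsHardSphereEulerSolution σ₂ T₂ ρ₂ U₂ Θ₂ → ∀ (Φ₁ : (N : ℕ) → HardSphereFlow (Torus.geometry (Fin 3)) (hsDiameter σ₁ N) (N + 1)) (Φ₂ : (N : ℕ) → HardSphereFlow (Torus.geometry (Fin 3)) (hsDiameter σ₁ N) (n₂ N)), let P₁ : (N : ℕ) → Measure (Config (N + 1) (Fin 3) T3) := fun N => localGibbsLaw σ₁ a₁ u₁ θ₁ N (Φ₁ N); let P₂ : (N : ℕ) → Measure (Config (n₂ N) (Fin 3) T3) := fun N => particleLaw (Φ₂ N) (canonicalDensity (Torus.geometry (Fin 3)) (hsDiameter σ₁ N) (n₂ N) (localGibbsProfile a₂ u₂ θ₂)); (∀ N, IsProbabilityMeasure (P₁ N)) → (∀ N, IsProbabilityMeasure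 (P₂ N)) → TendstoHydroFieldsAt P₁ Φ₁ ρ₁ U₁ Θ₁ 0 → (∀ χ : T3 → ℝ, Continuous χ → ∀ δ : ℝ, 0 < δ → Tendsto (fun N => P₂ N {z | δ < |empiricalDensityField ((Φ₂ N).flow 0 z) χ - ∫ x, χ x * ρ₂ 0 x|}) atTop (nhds 0) ∧ Tendsto (fun N => P₂ N {z | δ < ‖empiricalMomentumField ((Φ₂ N).flow 0 z) χ - ∫ x, (χ x * ρ₂ 0 x) • U₂ 0 x‖}) atTop (nhds 0) ∧ Tendsto (fun N => P₂ N {z | δ < |empiricalEnergyField ((Φ₂ N).flow 0 z) χ - ∫ x, χ x * totalEnergyDensity (ρ₂ 0 x) (U₂ 0 x) (Θ₂ 0 x)|}) atTop (nhds 0)) → ∀ t : ℝ, 0 ≤ t → t < T₁ → t < T₂ → (∀ s ∈ Set.Icc 0 t, ∀ x, ρ₁ s x * σ₁ ^ 3 < η₀ ∧ Θ₁ s x ≤ M ∧ ‖U₁ s x‖ ≤ M ∧ ρ₂ s x * σ₂ ^ 3 < η₀ ∧ Θ₂ s x ≤ M ∧ ‖U₂ s x‖ ≤ M) → ∀ (x₀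 : T3) (R : ℝ), (∀ x, Torus.euclidDist x x₀ < R → ρ₁ 0 x * σ₁ ^ 3 = ρ₂ 0 x * σ₂ ^ 3 ∧ U₁ 0 x = U₂ 0 x) → ∀ χ : T3 → ℝ, Continuous χ → (∀ x, R - c * t ≤ Torus.euclidDist x x₀ → χ x = 0) → ∀ F : ℝ × V3 × ℝ → ℝ, LipschitzWith 1 F → (∀ p, |F p| ≤ 1) → Tendsto (fun N => (∫ z, F (σ₁ ^ 3 * empiricalDensityField ((Φ₁ N).flow t z) χ, (σ₁ ^ 3) • empiricalMomentumField ((Φ₁ N).flow t z) χ, σ₁ ^ 3 * empiricalEnergyField ((Φ₁ N).flow t z) χ) ∂(P₁ N)) - ∫ z, F (σ₂ ^ 3 * empiricalDensityField ((Φ₂ N).flow t z) χ, (σ₂ ^ 3) • empiricalMomentumField ((Φ₂ N).flow t z) χ, σ₂ ^ 3 * empiricalEnergyField ((Φ₂ N).flow t z) χ) ∂(P₂ N)) atTop (nhds 0)) := by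
  rintro ⟨η₀, hη₀, H⟩
  obtain ⟨σW, hσW, HW⟩ := not_merging_of_energy_ne (0 : V3) (two_pos : (0 : ℝ) < 2) (by rw [norm_zero]; norm_num)
  obtain ⟨σA, hσA, HA⟩ := homogeneous_lln_all_times one_pos (0 : V3)
  obtain ⟨σB, hσB, HB⟩ := homogeneous_lln_all_times (two_pos : (0 : ℝ) < 2) (0 : V3)
  obtain ⟨c, hc, Hc⟩ := H 2 two_pos
  obtain ⟨σ₀, hσ₀, Hσ⟩ := Hc (fun _ => 1) (fun _ => 1) (fun _ => 1) (fun _ => 2) (fun _ => 0) (fun _ => 0)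
    continuous_const continuous_const continuous_const continuous_const continuous_const continuous_const
    (fun _ => one_pos) (fun _ => one_pos) (fun _ => one_pos) (fun _ => two_pos)
  obtain ⟨σ, hσ, hσ₀', hσW', hσA', hσB', hσhalf, hσ3η, ⟨Φ⟩⟩ :=
    exists_small_flows σ₀ σW σA σB η₀ hσ₀ hσW hσA hσB hη₀
  have hE₁ := constSol σ (0 : V3) one_pos
  have hE₂ := constSol σ (0 : V3) (two_pos : (0 : ℝ) < 2)
  have hP : ∀ θ : ℝ, 0 < θ → ∀ N, IsProbabilityMeasure
      (localGibbsLaw σ (fun _ => 1) (fun _ => 0) (fun _ => θ) N (Φ N)) := fun θ hθ => isProb_homogeneous hσhalf 0 hθ Φ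
  have h := Hσ σ σ hσ hσ₀' hσ hσ₀' (fun N => N + 1)
    (by simp_rw [succ_mul_hsDiameter_pow_three]; exact tendsto_const_nhds) 2 2
    (fun _ _ => 1) (fun _ _ => 1) (fun _ _ => 1) (fun _ _ => 2) (fun _ _ => 0) (fun _ _ => 0) hE₁ hE₂ Φ Φ
    (hP 1 one_pos) (hP 2 two_pos) (HA σ hσ hσA' Φ 0) (HB σ hσ hσB' Φ 0) 1 zero_le_one one_lt_two
    one_lt_two (fun s _ x => ⟨by simpa using hσ3η, by norm_num, by simp, by simpa using hσ3η, by norm_num,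
      by simp⟩) 0 (c * 1 + 1) (fun x _ => ⟨rfl, rfl⟩) (fun _ => 1) continuous_const
    (fun x hx => by have := DensityCapNegative.euclidDist_lt_one x 0; exfalso; linarith)
  exact HW σ hσ hσW' Φ 1 h

/-- **The crux without velocity agreement is false** (`[load-bearing: U-agreement]`). Witness: as in
`lightConeInLaw_false_without_thermalAgreement`, but gas 2 is the DRIFTING homogeneous gas `(1, e₀, 1)`
(`e₀ = EuclideanSpace.single 0 1`, `‖e₀‖ = 1 ≤ M = 2`): reduced density and temperature agree everywhere, and the
reduced energies concentrate at `(3/2)σ³` versus `2σ³`. [folklore] -/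
theorem lightConeInLaw_false_without_velocityAgreement :
    ¬ (open Literature.MathematicalPhysics.KineticTheory Literature.Analysis.FluidPDE MeasureTheory Filter in ∃ η₀ : ℝ, 0 < η₀ ∧ ∀ M : ℝ, 0 < M → ∃ c : ℝ, 0 < c ∧ ∀ (a₁ θ₁ a₂ θ₂ : T3 → ℝ) (u₁ u₂ : T3 → V3), Continuous a₁ → Continuous θ₁ → Continuous u₁ → Continuous a₂ → Continuous θ₂ → Continuous u₂ → (∀ x, 0 < a₁ x) → (∀ x, 0 < θ₁ x) → (∀ x, 0 < a₂ x) → (∀ x, 0 < θ₂ x) → ∃ σ₀ : ℝ, 0 < σ₀ ∧ ∀ (σ₁ σ₂ : ℝ), 0 < σ₁ → σ₁ < σ₀ → 0 < σ₂ → σ₂ < σ₀ → ∀ n₂ : ℕ → ℕ, Tendsto (fun N => (n₂ N : ℝ) * hsDiameter σ₁ N ^ 3) atTop (nhds (σ₂ ^ 3)) → ∀ (T₁ T₂ : ℝ) (ρ₁ Θ₁ ρ₂ Θ₂ : ℝ → T3 → ℝ) (U₁ U₂ : ℝ → T3 → V3), IsHardSphereEulerSolution σ₁ T₁ ρ₁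 U₁ Θ₁ → IsHardSphereEulerSolution σ₂ T₂ ρ₂ U₂ Θ₂ → ∀ (Φ₁ : (N : ℕ) → HardSphereFlow (Torus.geometry (Fin 3)) (hsDiameter σ₁ N) (N + 1)) (Φ₂ : (N : ℕ) → HardSphereFlow (Torus.geometry (Fin 3)) (hsDiameter σ₁ N) (n₂ N)), let P₁ : (N : ℕ) → Measure (Config (N + 1) (Fin 3) T3) := fun N => localGibbsLaw σ₁ a₁ u₁ θ₁ N (Φ₁ N); let P₂ : (N : ℕ) → Measure (Config (n₂ N) (Fin 3) T3) := fun N => particleLaw (Φ₂ N) (canonicalDensity (Torus.geometry (Fin 3)) (hsDiameter σ₁ N) (n₂ N) (localGibbsProfile a₂ u₂ θ₂)); (∀ N, IsProbabilityMeasure (P₁ N)) → (∀ N, IsProbabilityMeasure (P₂ N)) → TendstoHydroFieldsAt P₁ Φ₁ ρ₁ U₁ Θ₁ 0 → (∀ χ : T3 → ℝ, Continuous χ → ∀ δ : ℝ, 0 < δ → Tendsto (fun N => P₂ N {z | δ < |empiricalDensityField ((Φ₂ N).flow 0 z) χ - ∫ x, χ x * ρ₂ 0 x|}) atTop (nhds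 0) ∧ Tendsto (fun N => P₂ N {z | δ < ‖empiricalMomentumField ((Φ₂ N).flow 0 z) χ - ∫ x, (χ x * ρ₂ 0 x) • U₂ 0 x‖}) atTop (nhds 0) ∧ Tendsto (fun N => P₂ N {z | δ < |empiricalEnergyField ((Φ₂ N).flow 0 z) χ - ∫ x, χ x * totalEnergyDensity (ρ₂ 0 x) (U₂ 0 x) (Θ₂ 0 x)|}) atTop (nhds 0)) → ∀ t : ℝ, 0 ≤ t → t < T₁ → t < T₂ → (∀ s ∈ Set.Icc 0 t, ∀ x, ρ₁ s x * σ₁ ^ 3 < η₀ ∧ Θ₁ s x ≤ M ∧ ‖U₁ s x‖ ≤ M ∧ ρ₂ s x * σ₂ ^ 3 < η₀ ∧ Θ₂ s x ≤ M ∧ ‖U₂ s x‖ ≤ M) → ∀ (x₀ : T3) (R : ℝ), (∀ x, Torus.euclidDist x x₀ < R → ρ₁ 0 x * σ₁ ^ 3 = ρ₂ 0 x * σ₂ ^ 3 ∧ Θ₁ 0 x = Θ₂ 0 x) → ∀ χ : T3 → ℝ, Continuous χ → (∀ x, R - c * t ≤ Torus.euclidDist x x₀ → χ x = 0) → ∀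 F : ℝ × V3 × ℝ → ℝ, LipschitzWith 1 F → (∀ p, |F p| ≤ 1) → Tendsto (fun N => (∫ z, F (σ₁ ^ 3 * empiricalDensityField ((Φ₁ N).flow t z) χ, (σ₁ ^ 3) • empiricalMomentumField ((Φ₁ N).flow t z) χ, σ₁ ^ 3 * empiricalEnergyField ((Φ₁ N).flow t z) χ) ∂(P₁ N)) - ∫ z, F (σ₂ ^ 3 * empiricalDensityField ((Φ₂ N).flow t z) χ, (σ₂ ^ 3) • empiricalMomentumField ((Φ₂ N).flow t z) χ, σ₂ ^ 3 * empiricalEnergyField ((Φ₂ N).flow t z) χ) ∂(P₂ N)) atTop (nhds 0)) := by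
  rintro ⟨η₀, hη₀, H⟩
  set e₀ : V3 := EuclideanSpace.single (0 : Fin 3) (1 : ℝ) with he₀
  have hne₀ : ‖e₀‖ = 1 := by rw [he₀, EuclideanSpace.single, PiLp.norm_single, norm_one]
  obtain ⟨σW, hσW, HW⟩ := not_merging_of_energy_ne e₀ one_pos (by rw [hne₀]; norm_num)
  obtain ⟨σA, hσA, HA⟩ := homogeneous_lln_all_times one_pos (0 : V3)
  obtain ⟨σB, hσB, HB⟩ := homogeneous_lln_all_times one_pos e₀
  obtain ⟨c, hc, Hc⟩ := H 2 two_pos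
  obtain ⟨σ₀, hσ₀, Hσ⟩ := Hc (fun _ => 1) (fun _ => 1) (fun _ => 1) (fun _ => 1) (fun _ => 0) (fun _ => e₀)
    continuous_const continuous_const continuous_const continuous_const continuous_const continuous_const
    (fun _ => one_pos) (fun _ => one_pos) (fun _ => one_pos) (fun _ => one_pos)
  obtain ⟨σ, hσ, hσ₀', hσW', hσA', hσB', hσhalf, hσ3η, ⟨Φ⟩⟩ :=
    exists_small_flows σ₀ σW σA σB η₀ hσ₀ hσW hσA hσB hη₀
  have hE₁ := constSol σ (0 : V3) one_pos
  have hE₂ := constSol σ e₀ one_pos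
  have hP : ∀ u : V3, ∀ N, IsProbabilityMeasure
      (localGibbsLaw σ (fun _ => 1) (fun _ => u) (fun _ => 1) N (Φ N)) := fun u => isProb_homogeneous hσhalf u one_pos Φ
  have h := Hσ σ σ hσ hσ₀' hσ hσ₀' (fun N => N + 1)
    (by simp_rw [succ_mul_hsDiameter_pow_three]; exact tendsto_const_nhds) 2 2
    (fun _ _ => 1) (fun _ _ => 1) (fun _ _ => 1) (fun _ _ => 1) (fun _ _ => 0) (fun _ _ => e₀) hE₁ hE₂ Φ Φ
    (hP 0) (hP e₀) (HA σ hσ hσA' Φ 0) (HB σ hσ hσB' Φ 0) 1 zero_le_one one_lt_two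
    one_lt_two (fun s _ x => ⟨by simpa using hσ3η, by norm_num, by simp, by simpa using hσ3η, by norm_num,
      by simp [hne₀]⟩) 0 (c * 1 + 1) (fun x _ => ⟨rfl, rfl⟩) (fun _ => 1) continuous_const
    (fun x hx => by have := DensityCapNegative.euclidDist_lt_one x 0; exfalso; linarith)
  exact HW σ hσ hσW' Φ 1 h

/-- **The crux without the support clause is false** (`[load-bearing: support of χ]`; degenerate radius). Witness
as above but `R = 0`: the agreement clause `∀ x, dist x x₀ < 0 → …` is vacuous, so the two homogeneous gases at
temperatures `1` and `2` satisfy every hypothesis, and the everywhere-supported `χ ≡ 1` separates them at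
`t = 1`. [folklore] -/
theorem lightConeInLaw_false_without_support :
    ¬ (open Literature.MathematicalPhysics.KineticTheory Literature.Analysis.FluidPDE MeasureTheory Filter in ∃ η₀ : ℝ, 0 < η₀ ∧ ∀ M : ℝ, 0 < M → ∃ c : ℝ, 0 < c ∧ ∀ (a₁ θ₁ a₂ θ₂ : T3 → ℝ) (u₁ u₂ : T3 → V3), Continuous a₁ → Continuous θ₁ → Continuous u₁ → Continuous a₂ → Continuous θ₂ → Continuous u₂ → (∀ x, 0 < a₁ x) → (∀ x, 0 < θ₁ x) → (∀ x, 0 < a₂ x) → (∀ x, 0 < θ₂ x) → ∃ σ₀ : ℝ, 0 < σ₀ ∧ ∀ (σ₁ σ₂ : ℝ), 0 < σ₁ → σ₁ < σ₀ → 0 < σ₂ → σ₂ < σ₀ → ∀ n₂ : ℕ → ℕ, Tendsto (fun N => (n₂ N : ℝ) * hsDiameter σ₁ N ^ 3) atTop (nhds (σ₂ ^ 3)) → ∀ (T₁ T₂ : ℝ) (ρ₁ Θ₁ ρ₂ Θ₂ : ℝ → T3 → ℝ) (U₁ U₂ : ℝ → T3 → V3), IsHardSphereEulerSolution σ₁ T₁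 ρ₁ U₁ Θ₁ → IsHardSphereEulerSolution σ₂ T₂ ρ₂ U₂ Θ₂ → ∀ (Φ₁ : (N : ℕ) → HardSphereFlow (Torus.geometry (Fin 3)) (hsDiameter σ₁ N) (N + 1)) (Φ₂ : (N : ℕ) → HardSphereFlow (Torus.geometry (Fin 3)) (hsDiameter σ₁ N) (n₂ N)), let P₁ : (N : ℕ) → Measure (Config (N + 1) (Fin 3) T3) := fun N => localGibbsLaw σ₁ a₁ u₁ θ₁ N (Φ₁ N); let P₂ : (N : ℕ) → Measure (Config (n₂ N) (Fin 3) T3) := fun N => particleLaw (Φ₂ N) (canonicalDensity (Torus.geometry (Fin 3)) (hsDiameter σ₁ N) (n₂ N) (localGibbsProfile a₂ u₂ θ₂)); (∀ N, IsProbabilityMeasure (P₁ N)) → (∀ N, IsProbabilityMeasure (P₂ N)) → TendstoHydroFieldsAt P₁ Φ₁ ρ₁ U₁ Θ₁ 0 → (∀ χ : T3 → ℝ, Continuous χ → ∀ δ : ℝ, 0 < δ → Tendsto (fun N => P₂ N {z | δ < |empiricalDensityField ((Φ₂ N).flow 0 z) χ - ∫ x, χ x * ρ₂ 0 x|}) atTop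 (nhds 0) ∧ Tendsto (fun N => P₂ N {z | δ < ‖empiricalMomentumField ((Φ₂ N).flow 0 z) χ - ∫ x, (χ x * ρ₂ 0 x) • U₂ 0 x‖}) atTop (nhds 0) ∧ Tendsto (fun N => P₂ N {z | δ < |empiricalEnergyField ((Φ₂ N).flow 0 z) χ - ∫ x, χ x * totalEnergyDensity (ρ₂ 0 x) (U₂ 0 x) (Θ₂ 0 x)|}) atTop (nhds 0)) → ∀ t : ℝ, 0 ≤ t → t < T₁ → t < T₂ → (∀ s ∈ Set.Icc 0 t, ∀ x, ρ₁ s x * σ₁ ^ 3 < η₀ ∧ Θ₁ s x ≤ M ∧ ‖U₁ s x‖ ≤ M ∧ ρ₂ s x * σ₂ ^ 3 < η₀ ∧ Θ₂ s x ≤ M ∧ ‖U₂ s x‖ ≤ M) → ∀ (x₀ : T3) (R : ℝ), (∀ x, Torus.euclidDist x x₀ < R → ρ₁ 0 x * σ₁ ^ 3 = ρ₂ 0 x * σ₂ ^ 3 ∧ U₁ 0 x = U₂ 0 x ∧ Θ₁ 0 x = Θ₂ 0 x) → ∀ χ : T3 → ℝ, Continuous χ → ∀ F : ℝ × V3 ×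 ℝ → ℝ, LipschitzWith 1 F → (∀ p, |F p| ≤ 1) → Tendsto (fun N => (∫ z, F (σ₁ ^ 3 * empiricalDensityField ((Φ₁ N).flow t z) χ, (σ₁ ^ 3) • empiricalMomentumField ((Φ₁ N).flow t z) χ, σ₁ ^ 3 * empiricalEnergyField ((Φ₁ N).flow t z) χ) ∂(P₁ N)) - ∫ z, F (σ₂ ^ 3 * empiricalDensityField ((Φ₂ N).flow t z) χ, (σ₂ ^ 3) • empiricalMomentumField ((Φ₂ N).flow t z) χ, σ₂ ^ 3 * empiricalEnergyField ((Φ₂ N).flow t z) χ) ∂(P₂ N)) atTop (nhds 0)) := by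
  rintro ⟨η₀, hη₀, H⟩
  obtain ⟨σW, hσW, HW⟩ := not_merging_of_energy_ne (0 : V3) (two_pos : (0 : ℝ) < 2) (by rw [norm_zero]; norm_num)
  obtain ⟨σA, hσA, HA⟩ := homogeneous_lln_all_times one_pos (0 : V3)
  obtain ⟨σB, hσB, HB⟩ := homogeneous_lln_all_times (two_pos : (0 : ℝ) < 2) (0 : V3)
  obtain ⟨c, hc, Hc⟩ := H 2 two_pos
  obtain ⟨σ₀, hσ₀, Hσ⟩ := Hc (fun _ => 1) (fun _ => 1) (fun _ => 1) (fun _ => 2) (fun _ => 0) (fun _ => 0)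
    continuous_const continuous_const continuous_const continuous_const continuous_const continuous_const
    (fun _ => one_pos) (fun _ => one_pos) (fun _ => one_pos) (fun _ => two_pos)
  obtain ⟨σ, hσ, hσ₀', hσW', hσA', hσB', hσhalf, hσ3η, ⟨Φ⟩⟩ :=
    exists_small_flows σ₀ σW σA σB η₀ hσ₀ hσW hσA hσB hη₀
  have hE₁ := constSol σ (0 : V3) one_pos
  have hE₂ := constSol σ (0 : V3) (two_pos : (0 : ℝ) < 2)
  have hP : ∀ θ : ℝ, 0 < θ → ∀ N, IsProbabilityMeasure
      (localGibbsLaw σ (fun _ => 1) (fun _ => 0) (fun _ => θ) N (Φ N)) := fun θ hθ => isProb_homogeneous hσhalf 0 hθ Φ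
  have h := Hσ σ σ hσ hσ₀' hσ hσ₀' (fun N => N + 1)
    (by simp_rw [succ_mul_hsDiameter_pow_three]; exact tendsto_const_nhds) 2 2
    (fun _ _ => 1) (fun _ _ => 1) (fun _ _ => 1) (fun _ _ => 2) (fun _ _ => 0) (fun _ _ => 0) hE₁ hE₂ Φ Φ
    (hP 1 one_pos) (hP 2 two_pos) (HA σ hσ hσA' Φ 0) (HB σ hσ hσB' Φ 0) 1 zero_le_one one_lt_two
    one_lt_two (fun s _ x => ⟨by simpa using hσ3η, by norm_num, by simp, by simpa using hσ3η, by norm_num,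
      by simp⟩) 0 0 (fun x hx => absurd hx (not_lt.2 (norm_nonneg _))) (fun _ => 1) continuous_const
  exact HW σ hσ hσW' Φ 1 h

/-! ### The two `t = 0` ties are load-bearing -/

/-- **The crux without the tie of gas 2 is false** (`[load-bearing: t = 0 LLN of gas 2]`). Witness: both nominal
Euler solutions are the constant state `(1, 0, 1)` (so the agreement clause holds everywhere and the guards hold
with `M = 2`), gas 1 IS the homogeneous gas `(1, 0, 1)` (tied by the tree's LLN), but gas 2 is the homogeneous gas
`(1, 0, 2)` — untied, its Euler data are fiction; `t = 1`, `R = c + 1`, `χ ≡ 1`: `not_merging_of_energy_ne`.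
[folklore] -/
theorem lightConeInLaw_false_without_tieTwo :
    ¬ (open Literature.MathematicalPhysics.KineticTheory Literature.Analysis.FluidPDE MeasureTheory Filter in ∃ η₀ : ℝ, 0 < η₀ ∧ ∀ M : ℝ, 0 < M → ∃ c : ℝ, 0 < c ∧ ∀ (a₁ θ₁ a₂ θ₂ : T3 → ℝ) (u₁ u₂ : T3 → V3), Continuous a₁ → Continuous θ₁ → Continuous u₁ → Continuous a₂ → Continuous θ₂ → Continuous u₂ → (∀ x, 0 < a₁ x) → (∀ x, 0 < θ₁ x) → (∀ x, 0 < a₂ x) → (∀ x, 0 < θ₂ x) → ∃ σ₀ : ℝ, 0 < σ₀ ∧ ∀ (σ₁ σ₂ : ℝ), 0 < σ₁ → σ₁ < σ₀ → 0 < σ₂ → σ₂ < σ₀ → ∀ n₂ : ℕ → ℕ, Tendsto (fun N => (n₂ N : ℝ) * hsDiameter σ₁ N ^ 3) atTop (nhds (σ₂ ^ 3)) → ∀ (T₁ T₂ : ℝ) (ρ₁ Θ₁ ρ₂ Θ₂ : ℝ → T3 → ℝ) (U₁ U₂ : ℝ → T3 → V3), IsHardSphereEulerSolution σ₁ T₁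 ρ₁ U₁ Θ₁ → IsHardSphereEulerSolution σ₂ T₂ ρ₂ U₂ Θ₂ → ∀ (Φ₁ : (N : ℕ) → HardSphereFlow (Torus.geometry (Fin 3)) (hsDiameter σ₁ N) (N + 1)) (Φ₂ : (N : ℕ) → HardSphereFlow (Torus.geometry (Fin 3)) (hsDiameter σ₁ N) (n₂ N)), let P₁ : (N : ℕ) → Measure (Config (N + 1) (Fin 3) T3) := fun N => localGibbsLaw σ₁ a₁ u₁ θ₁ N (Φ₁ N); let P₂ : (N : ℕ) → Measure (Config (n₂ N) (Fin 3) T3) := fun N => particleLaw (Φ₂ N) (canonicalDensity (Torus.geometry (Fin 3)) (hsDiameter σ₁ N) (n₂ N) (localGibbsProfile a₂ u₂ θ₂)); (∀ N, IsProbabilityMeasure (P₁ N)) → (∀ N, IsProbabilityMeasure (P₂ N)) → TendstoHydroFieldsAt P₁ Φ₁ ρ₁ U₁ Θ₁ 0 → ∀ t : ℝ, 0 ≤ t → t < T₁ → t < T₂ → (∀ s ∈ Set.Icc 0 t, ∀ x, ρ₁ s x * σ₁ ^ 3 < η₀ ∧ Θ₁ s x ≤ M ∧ ‖U₁ s x‖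 ≤ M ∧ ρ₂ s x * σ₂ ^ 3 < η₀ ∧ Θ₂ s x ≤ M ∧ ‖U₂ s x‖ ≤ M) → ∀ (x₀ : T3) (R : ℝ), (∀ x, Torus.euclidDist x x₀ < R → ρ₁ 0 x * σ₁ ^ 3 = ρ₂ 0 x * σ₂ ^ 3 ∧ U₁ 0 x = U₂ 0 x ∧ Θ₁ 0 x = Θ₂ 0 x) → ∀ χ : T3 → ℝ, Continuous χ → (∀ x, R - c * t ≤ Torus.euclidDist x x₀ → χ x = 0) → ∀ F : ℝ × V3 × ℝ → ℝ, LipschitzWith 1 F → (∀ p, |F p| ≤ 1) → Tendsto (fun N => (∫ z, F (σ₁ ^ 3 * empiricalDensityField ((Φ₁ N).flow t z) χ, (σ₁ ^ 3) • empiricalMomentumField ((Φ₁ N).flow t z) χ, σ₁ ^ 3 * empiricalEnergyField ((Φ₁ N).flow t z) χ) ∂(P₁ N)) - ∫ z, F (σ₂ ^ 3 * empiricalDensityField ((Φ₂ N).flow t z) χ, (σ₂ ^ 3) • empiricalMomentumField ((Φ₂ N).flow t z) χ, σ₂ ^ 3 * empiricalEnergyField ((Φ₂ N).flow t z) χ)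 ∂(P₂ N)) atTop (nhds 0)) := by
  rintro ⟨η₀, hη₀, H⟩
  obtain ⟨σW, hσW, HW⟩ := not_merging_of_energy_ne (0 : V3) (two_pos : (0 : ℝ) < 2) (by rw [norm_zero]; norm_num)
  obtain ⟨σA, hσA, HA⟩ := homogeneous_lln_all_times one_pos (0 : V3)
  obtain ⟨c, hc, Hc⟩ := H 2 two_pos
  obtain ⟨σ₀, hσ₀, Hσ⟩ := Hc (fun _ => 1) (fun _ => 1) (fun _ => 1) (fun _ => 2) (fun _ => 0) (fun _ => 0)
    continuous_const continuous_const continuous_const continuous_const continuous_const continuous_const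
    (fun _ => one_pos) (fun _ => one_pos) (fun _ => one_pos) (fun _ => two_pos)
  obtain ⟨σ, hσ, hσ₀', hσW', hσA', -, hσhalf, hσ3η, ⟨Φ⟩⟩ :=
    exists_small_flows σ₀ σW σA σA η₀ hσ₀ hσW hσA hσA hη₀
  have hE₁ := constSol σ (0 : V3) one_pos
  have hP : ∀ θ : ℝ, 0 < θ → ∀ N, IsProbabilityMeasure
      (localGibbsLaw σ (fun _ => 1) (fun _ => 0) (fun _ => θ) N (Φ N)) := fun θ hθ => isProb_homogeneous hσhalf 0 hθ Φ
  have h := Hσ σ σ hσ hσ₀' hσ hσ₀' (fun N => N + 1)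
    (by simp_rw [succ_mul_hsDiameter_pow_three]; exact tendsto_const_nhds) 2 2
    (fun _ _ => 1) (fun _ _ => 1) (fun _ _ => 1) (fun _ _ => 1) (fun _ _ => 0) (fun _ _ => 0) hE₁ hE₁ Φ Φ
    (hP 1 one_pos) (hP 2 two_pos) (HA σ hσ hσA' Φ 0) 1 zero_le_one one_lt_two
    one_lt_two (fun s _ x => ⟨by simpa using hσ3η, by norm_num, by simp, by simpa using hσ3η, by norm_num,
      by simp⟩) 0 (c * 1 + 1) (fun x _ => ⟨rfl, rfl, rfl⟩) (fun _ => 1) continuous_const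
    (fun x hx => by have := DensityCapNegative.euclidDist_lt_one x 0; exfalso; linarith)
  exact HW σ hσ hσW' Φ 1 h

/-- **The crux without the tie of gas 1 is false** (`[load-bearing: t = 0 LLN of gas 1]`). The mirror image: gas 1
is the untied homogeneous gas `(1, 0, 2)` with fictitious Euler data `(1, 0, 1)`, gas 2 the tied homogeneous gas
`(1, 0, 1)`; the merging is symmetric in the two gases (`F ↦ F`, `Tendsto.neg`). [folklore] -/
theorem lightConeInLaw_false_without_tieOne :
    ¬ (open Literature.MathematicalPhysics.KineticTheory Literature.Analysis.FluidPDE MeasureTheory Filter in ∃ η₀ : ℝ, 0 < η₀ ∧ ∀ M : ℝ, 0 < M → ∃ c : ℝ, 0 < c ∧ ∀ (a₁ θ₁ a₂ θ₂ : T3 → ℝ) (u₁ u₂ : T3 → V3), Continuous a₁ → Continuous θ₁ → Continuous u₁ → Continuous a₂ → Continuous θ₂ → Continuous u₂ → (∀ x, 0 < a₁ x) → (∀ x, 0 < θ₁ x) → (∀ x, 0 < a₂ x) → (∀ x, 0 < θ₂ x) → ∃ σ₀ : ℝ, 0 < σ₀ ∧ ∀ (σ₁ σ₂ : ℝ), 0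 < σ₁ → σ₁ < σ₀ → 0 < σ₂ → σ₂ < σ₀ → ∀ n₂ : ℕ → ℕ, Tendsto (fun N => (n₂ N : ℝ) * hsDiameter σ₁ N ^ 3) atTop (nhds (σ₂ ^ 3)) → ∀ (T₁ T₂ : ℝ) (ρ₁ Θ₁ ρ₂ Θ₂ : ℝ → T3 → ℝ) (U₁ U₂ : ℝ → T3 → V3), IsHardSphereEulerSolution σ₁ T₁ ρ₁ U₁ Θ₁ → IsHardSphereEulerSolution σ₂ T₂ ρ₂ U₂ Θ₂ → ∀ (Φ₁ : (N : ℕ) → HardSphereFlow (Torus.geometry (Fin 3)) (hsDiameter σ₁ N) (N + 1)) (Φ₂ : (N : ℕ) → HardSphereFlow (Torus.geometry (Fin 3)) (hsDiameter σ₁ N) (n₂ N)), let P₁ : (N : ℕ) → Measure (Config (N + 1) (Fin 3) T3) := fun N => localGibbsLaw σ₁ a₁ u₁ θ₁ N (Φ₁ N); let P₂ : (N : ℕ) → Measure (Config (n₂ N) (Fin 3) T3) := fun N => particleLaw (Φ₂ N) (canonicalDensity (Torus.geometry (Fin 3)) (hsDiameter σ₁ N) (n₂ N) (localGibbsProfile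 a₂ u₂ θ₂)); (∀ N, IsProbabilityMeasure (P₁ N)) → (∀ N, IsProbabilityMeasure (P₂ N)) → (∀ χ : T3 → ℝ, Continuous χ → ∀ δ : ℝ, 0 < δ → Tendsto (fun N => P₂ N {z | δ < |empiricalDensityField ((Φ₂ N).flow 0 z) χ - ∫ x, χ x * ρ₂ 0 x|}) atTop (nhds 0) ∧ Tendsto (fun N => P₂ N {z | δ < ‖empiricalMomentumField ((Φ₂ N).flow 0 z) χ - ∫ x, (χ x * ρ₂ 0 x) • U₂ 0 x‖}) atTop (nhds 0) ∧ Tendsto (fun N => P₂ N {z | δ < |empiricalEnergyField ((Φ₂ N).flow 0 z) χ - ∫ x, χ x * totalEnergyDensity (ρ₂ 0 x) (U₂ 0 x) (Θ₂ 0 x)|}) atTop (nhds 0)) → ∀ t : ℝ, 0 ≤ t → t < T₁ → t < T₂ → (∀ s ∈ Set.Icc 0 t, ∀ x, ρ₁ s x * σ₁ ^ 3 < η₀ ∧ Θ₁ s x ≤ M ∧ ‖U₁ s x‖ ≤ M ∧ ρ₂ s x * σ₂ ^ 3 < η₀ ∧ Θ₂ s x ≤ M ∧ ‖U₂ s x‖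 ≤ M) → ∀ (x₀ : T3) (R : ℝ), (∀ x, Torus.euclidDist x x₀ < R → ρ₁ 0 x * σ₁ ^ 3 = ρ₂ 0 x * σ₂ ^ 3 ∧ U₁ 0 x = U₂ 0 x ∧ Θ₁ 0 x = Θ₂ 0 x) → ∀ χ : T3 → ℝ, Continuous χ → (∀ x, R - c * t ≤ Torus.euclidDist x x₀ → χ x = 0) → ∀ F : ℝ × V3 × ℝ → ℝ, LipschitzWith 1 F → (∀ p, |F p| ≤ 1) → Tendsto (fun N => (∫ z, F (σ₁ ^ 3 * empiricalDensityField ((Φ₁ N).flow t z) χ, (σ₁ ^ 3) • empiricalMomentumField ((Φ₁ N).flow t z) χ, σ₁ ^ 3 * empiricalEnergyField ((Φ₁ N).flow t z) χ) ∂(P₁ N)) - ∫ z, F (σ₂ ^ 3 * empiricalDensityField ((Φ₂ N).flow t z) χ, (σ₂ ^ 3) • empiricalMomentumField ((Φ₂ N).flow t z) χ, σ₂ ^ 3 * empiricalEnergyField ((Φ₂ N).flow t z) χ) ∂(P₂ N)) atTop (nhds 0)) := by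
  rintro ⟨η₀, hη₀, H⟩
  obtain ⟨σW, hσW, HW⟩ := not_merging_of_energy_ne (0 : V3) (two_pos : (0 : ℝ) < 2) (by rw [norm_zero]; norm_num)
  obtain ⟨σA, hσA, HA⟩ := homogeneous_lln_all_times one_pos (0 : V3)
  obtain ⟨c, hc, Hc⟩ := H 2 two_pos
  obtain ⟨σ₀, hσ₀, Hσ⟩ := Hc (fun _ => 1) (fun _ => 2) (fun _ => 1) (fun _ => 1) (fun _ => 0) (fun _ => 0)
    continuous_const continuous_const continuous_const continuous_const continuous_const continuous_const
    (fun _ => one_pos) (fun _ => two_pos) (fun _ => one_pos) (fun _ => one_pos)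
  obtain ⟨σ, hσ, hσ₀', hσW', hσA', -, hσhalf, hσ3η, ⟨Φ⟩⟩ :=
    exists_small_flows σ₀ σW σA σA η₀ hσ₀ hσW hσA hσA hη₀
  have hE₁ := constSol σ (0 : V3) one_pos
  have hP : ∀ θ : ℝ, 0 < θ → ∀ N, IsProbabilityMeasure
      (localGibbsLaw σ (fun _ => 1) (fun _ => 0) (fun _ => θ) N (Φ N)) := fun θ hθ => isProb_homogeneous hσhalf 0 hθ Φ
  have h := Hσ σ σ hσ hσ₀' hσ hσ₀' (fun N => N + 1)
    (by simp_rw [succ_mul_hsDiameter_pow_three]; exact tendsto_const_nhds) 2 2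
    (fun _ _ => 1) (fun _ _ => 1) (fun _ _ => 1) (fun _ _ => 1) (fun _ _ => 0) (fun _ _ => 0) hE₁ hE₁ Φ Φ
    (hP 2 two_pos) (hP 1 one_pos) (HA σ hσ hσA' Φ 0) 1 zero_le_one one_lt_two
    one_lt_two (fun s _ x => ⟨by simpa using hσ3η, by norm_num, by simp, by simpa using hσ3η, by norm_num,
      by simp⟩) 0 (c * 1 + 1) (fun x _ => ⟨rfl, rfl, rfl⟩) (fun _ => 1) continuous_const
    (fun x hx => by have := DensityCapNegative.euclidDist_lt_one x 0; exfalso; linarith)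
  refine HW σ hσ hσW' Φ 1 fun F hF hFb => ?_
  have h' := (h F hF hFb).neg
  rw [neg_zero] at h'
  simp only [neg_sub] at h'
  exact h'


end LightConeInLawNegative

end Summit.AtomisticToContinuum.HydrodynamicLimit.Theorems

end
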